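import Literature.Probability.LatticeModels.SubharmonicGradientBound
import HarnessLib

/-!
# The sandwich gradient bound with a general height

Topic `Literature/Probability/LatticeModels`; a corollary of `SubharmonicGradientBound.lean`
(`sum_abs_sub_le_of_subharmonic_le_superharmonic`: `s` subharmonic, `w` superharmonic,
`0 ≤ s ≤ 1`, `w ≤ s ≤ w + 1` on a box of side `4m` ⇒ `∑_{ball m} |∇s| ≤ C m`, Smirnov 2010 Lemma 5.3
in the tree's rendering). For the primitive `H = (Hw, Hb)` of the spin fermion
(Chelkak–Hongler–Izyurov 2015, Prop. 3.6: `Hb` subharmonic, `Hw` superharmonic, `Hw ≤ Hb` across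
corners — `IsingDisorderLaplacian.lean`) there is no a priori normalisation `0 ≤ H ≤ 1`; what the
convergence theory supplies instead (CHI 2015, Thm 3.12 after Chelkak–Smirnov 2012, Thm 3.12) is a
uniform bound `|H| ≤ M` on compacts. This file rescales: if `|s|, |w| ≤ M` and `w ≤ s` then
`s' = (s + M)/(2M)`, `w' = (w + M)/(2M)` satisfy the unit sandwich, whence

* `sum_abs_sub_le_of_sandwich_bound`: `∑_{ball m} |∇s| ≤ 2 M C m`;
* `sum_abs_sub_le_of_sandwich_bound'`: `∑_{ball m} |∇w| ≤ 2 M C m` (apply the first to `(-w, -s)`).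

Everything is proved; no named fact.

## References

* S. Smirnov, Ann. of Math. 172 (2010), Lemma 5.3 [Smirnov2010].
* D. Chelkak, C. Hongler, K. Izyurov, Ann. of Math. 181 (2015), Prop. 3.6 and Thm 3.12
  [ChelkakHonglerIzyurovAnnals2015].
-/

noncomputable section

namespace Literature.Probability.LatticeModels

open Finset Real

variable {a : Site 2} {m : ℕ}

/-- **Gradient bound for the subharmonic member of a bounded sandwich**: `s` subharmonic on the
ball of radius `4m`, `w` superharmonic on the box interior, `|s|, |w| ≤ M` and `w ≤ s` on the ball
of radius `4m + 1`; then `∑_{x ∈ ball m} ∑_k |s(x + e_k) - s(x)| ≤ 2 M C m`. [cite: Smirnov2010, Lemma 5.3; ChelkakHonglerIzyurovAnnals2015, Thm 3.12] -/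
theorem sum_abs_sub_le_of_sandwich_bound (hm : 4 ≤ m) {s w : Site 2 → ℝ} {M : ℝ} (hM : 0 < M)
    (hsub : IsLatticeSubharmonicOn s (latticeBall (boxCentre a m) (2 * (2 * m)) : Set (Site 2)))
    (hsup : IsLatticeSuperharmonicOn w (boxInterior a (4 * m)))
    (hs : ∀ x ∈ latticeBall (boxCentre a m) (2 * (2 * m) + 1), |s x| ≤ M)
    (hw : ∀ x ∈ latticeBall (boxCentre a m) (2 * (2 * m) + 1), |w x| ≤ M)
    (hws : ∀ x ∈ latticeBall (boxCentre a m) (2 * (2 * m) + 1), w x ≤ s x) :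
    ∑ x ∈ latticeBall (boxCentre a m) m, ∑ k : Fin 4, |s (x + cornerUnit k) - s x| ≤ 2 * M * (energyGradConst * m) := by
  have h2M : 0 < 2 * M := by positivity
  have key := sum_abs_sub_le_of_subharmonic_le_superharmonic (a := a) hm (s := fun x => (2 * M)⁻¹ * (s x + M))
    (w := fun x => (2 * M)⁻¹ * (w x + M)) ?_ ?_ ?_ ?_
  · -- unscale
    have hterm : ∀ x (k : Fin 4), |(2 * M)⁻¹ * (s (x + cornerUnit k) + M) - (2 * M)⁻¹ * (s x + M)| =
        (2 * M)⁻¹ * |s (x + cornerUnit k) - s x| := by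
      intro x k
      rw [← mul_sub, abs_mul, abs_of_pos (inv_pos.2 h2M)]
      congr 1; ring_nf
    simp only [hterm, ← Finset.mul_sum] at key
    rwa [inv_mul_le_iff₀ h2M] at key
  · intro x hx
    rw [latticeLaplacian_const_mul, latticeLaplacian_add_const]
    exact mul_nonneg (inv_pos.2 h2M).le (hsub x hx)
  · intro x hx
    have h1 := hs x hx
    rw [abs_le] at h1
    constructor
    · exact mul_nonneg (inv_pos.2 h2M).le (by linarith)
    · rw [inv_mul_le_iff₀ h2M]; linarith
  · intro x hx
    rw [latticeLaplacian_const_mul, latticeLaplacian_add_const]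
    exact mul_nonpos_of_nonneg_of_nonpos (inv_pos.2 h2M).le (hsup x hx)
  · intro x hx
    have hx' : x ∈ latticeBall (boxCentre a m) (2 * (2 * m) + 1) := latticeBall_subset (by omega) hx
    have h1 := hws x hx'
    have h2 := hs x hx'
    have h3 := hw x hx'
    rw [abs_le] at h2 h3
    have hi := (inv_pos.2 h2M).le
    constructor
    · exact mul_le_mul_of_nonneg_left (by linarith) hi
    · have e1 : (2 * M)⁻¹ * (w x + M) + 1 = (2 * M)⁻¹ * (w x + M + 2 * M) := by
        rw [mul_add (2 * M)⁻¹ (w x + M) (2 * M), inv_mul_cancel₀ h2M.ne']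
      rw [e1]
      exact mul_le_mul_of_nonneg_left (by linarith) hi

/-- **Gradient bound for the superharmonic member of a bounded sandwich** (apply the previous
statement to the pair `(-w, -s)`): `∑_{x ∈ ball m} ∑_k |w(x + e_k) - w(x)| ≤ 2 M C m`. [cite: Smirnov2010, Lemma 5.3; ChelkakHonglerIzyurovAnnals2015, Thm 3.12] -/
theorem sum_abs_sub_le_of_sandwich_bound' (hm : 4 ≤ m) {s w : Site 2 → ℝ} {M : ℝ} (hM : 0 < M)
    (hsub : IsLatticeSubharmonicOn s (boxInterior a (4 * m)))
    (hsup : IsLatticeSuperharmonicOn w (latticeBall (boxCentre a m) (2 * (2 * m)) : Set (Site 2)))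
    (hs : ∀ x ∈ latticeBall (boxCentre a m) (2 * (2 * m) + 1), |s x| ≤ M)
    (hw : ∀ x ∈ latticeBall (boxCentre a m) (2 * (2 * m) + 1), |w x| ≤ M)
    (hws : ∀ x ∈ latticeBall (boxCentre a m) (2 * (2 * m) + 1), w x ≤ s x) :
    ∑ x ∈ latticeBall (boxCentre a m) m, ∑ k : Fin 4, |w (x + cornerUnit k) - w x| ≤ 2 * M * (energyGradConst * m) := by
  have key := sum_abs_sub_le_of_sandwich_bound (a := a) hm hM (s := fun x => -w x) (w := fun x => -s x) ?_ ?_ ?_ ?_ ?_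
  · refine le_trans (le_of_eq (Finset.sum_congr rfl fun x _ => Finset.sum_congr rfl fun k _ => ?_)) key
    rw [show -w (x + cornerUnit k) - -w x = -(w (x + cornerUnit k) - w x) by ring, abs_neg]
  · intro x hx
    have := latticeLaplacian_neg w x
    rw [show (-w) = (fun x => -w x) from rfl] at this
    rw [this]; linarith [hsup x hx]
  · intro x hx
    have := latticeLaplacian_neg s x
    rw [show (-s) = (fun x => -s x) from rfl] at this
    rw [this]; linarith [hsub x hx]
  · intro x hx; rw [abs_neg]; exact hw x hx
  · intro x hx; rw [abs_neg]; exact hs x hx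
  · intro x hx; linarith [hws x hx]

end Literature.Probability.LatticeModels
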